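import Summits.QuantumFields.YangMills.Theorems.VirialFluxGapRingTreeGauge
import HarnessLib

/-!
# Tree gauge on slice 0 of a ring history whose seam is glued through a SITE RE-INDEXING `κ` (e.g. the axis swap `σ` of the σ-glued ring
# `TT.twistTrace`): the ring integral of a functional invariant under `(U⃗, g) ↦ (h·U⃗, h·g·(h∘κ)⁻¹)`, exactly, on the reduced space
# (free-hands support of item stmt-QuantumFields-24197 `SwapVirialDeficit.SwapGluedStiffness` — the TREE-GAUGE HOST of the σ-glued ring; brick (α2-i) of LEAD
# ym-line-sfw-p2 g93's 05:57Z programme for the fixed-`L` floor (α) ∕ ceiling (β) of the swap-twisted zero-flux trace)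

✓`RingDeficit.lintegral_ringMeasure_eq_treeGauge` (w2 g49) reduces the ring integral of a functional invariant under the DIAGONAL slice gauge action
`(U⃗, g) ↦ (h·U⃗, h g h⁻¹)` to the tree-gauged space `SU(2)^{off} × (slices 1…2L−1) × (seam)`.  The σ-glued ring's seam bond
`K(U_{2L−1}, g·tw_z σU_0)` is instead invariant under `(U⃗, g) ↦ (h·U⃗, h·g·(h∘κ)⁻¹)` with `κ` the site swap (✓`configPerm_gaugeTransform`:
`σ(h·U) = (h∘κ)·σU`).  This file proves the reduction for an ARBITRARY site map `κ` — the same proof: the comb transporter `γ` of slice `0` is moved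
onto the other slices (`Elitzur.measurePreserving_gaugeTransform`) and onto the seam field by `g ↦ γ·g·(γ∘κ)⁻¹`, which preserves product Haar
sitewise (`measurePreserving_mul_mul_inv_haarProbability (γ x) (γ (κ x))`); the tree links then integrate to `1`.

* ★ `lintegral_ringMeasure_eq_treeGauge_seam`, ★ `integral_ringMeasure_eq_treeGauge_seam`;
* ★ `integral_ringMeasure_eq_integral_fix_seam` (Fubini to the product group `X_fix`), ★ `measureReal_le_eq_fix_seam` (sublevel volumes `μ_L{F ≤ s} = μ_fix{F∘fix ≤ s}`
  for any measurable `F` invariant under the re-indexed seam action).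

HONEST FRAMING: measure-theoretic bookkeeping (the host only: no deficit bound, no floor, no ceiling); ⟨24197⟩, ⟨24194⟩ and every rung stay OPEN; the
Yang–Mills mass gap is NOT proved; no summit is proved by a line.  THEOREMS ONLY (0 `def`, 0 `sorry`), standard axioms.  Width seat ym-line-sfw-p2-w3 g61
(cell ym-idea-1, free hands), `--supports stmt-QuantumFields-24197`.  References: [cite: SeilerLNP1982, §2]; [cite: tHooft1979]; [cite: MontvayMunster1994, (3.145)].
-/

noncomputable section

open MeasureTheory Filter Set Function
open scoped BigOperators Topology ENNReal
open Literature.MathematicalPhysics.QuantumFieldTheory hiding SU2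
open Literature.MathematicalPhysics.QuantumLattice (measurePreserving_mul_mul_inv_haarProbability)
open Summit.QuantumFields.YangMills.Theorems.FemtoTransferGap
open Summit.QuantumFields.YangMills.Theorems.FemtoTransferGap.TT

namespace Summit.QuantumFields.YangMills.Theorems.VirialFluxGap.RingDeficit

variable {L : ℕ} [NeZero L]

/-- ★ **The ring integral in tree gauge, for a functional invariant under a RE-INDEXED seam action** (`ℝ≥0∞`-valued): for a site map `κ` and
measurable `G` with `G(h·U⃗, h·g·(h∘κ)⁻¹) = G(U⃗, g)` for all gauge transformations `h` (`κ = id`: the diagonal action of ✓`lintegral_ringMeasure_eq_treeGauge`;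
`κ` = the site swap of the axes `0,1`: the invariance of the σ-GLUED ring),
`∫ G d(ringMeasure L) = ∫_{w} ∫_{r} G(glue w ∷ r) d((⊗_j configMeasure) ⊗ gaugeMeasure)(r) dHaar^{off}(w)`. [cite: SeilerLNP1982, §2] -/
theorem lintegral_ringMeasure_eq_treeGauge_seam (κ : Site 3 L → Site 3 L)
    {G : (Fin (2 * L - 1 + 1) → GaugeConfig 3 L SU2) × (Site 3 L → SU2) → ℝ≥0∞} (hG : Measurable G)
    (hinv : ∀ (h : Site 3 L → SU2) (p : (Fin (2 * L - 1 + 1) → GaugeConfig 3 L SU2) × (Site 3 L → SU2)),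
      G ((fun i => gaugeTransform h (p.1 i)), h * p.2 * (h ∘ κ)⁻¹) = G p) :
    ∫⁻ p, G p ∂(ringMeasure L) =
      ∫⁻ w, ∫⁻ r, G ((Fin.cons (glue w) r.1 : Fin (2 * L - 1 + 1) → GaugeConfig 3 L SU2), r.2)
        ∂((Measure.pi fun _ : Fin (2 * L - 1) => configMeasure SU2 L).prod (gaugeMeasure L))
        ∂(Measure.pi fun _ : OffIdx L => haarProbability SU2) := by
  haveI : IsProbabilityMeasure (gaugeMeasure L) := by unfold gaugeMeasure; infer_instance
  set ρ : Measure ((Fin (2 * L - 1) → GaugeConfig 3 L SU2) × (Site 3 L → SU2)) :=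
    (Measure.pi fun _ : Fin (2 * L - 1) => configMeasure SU2 L).prod (gaugeMeasure L) with hρ
  set τ : Measure (TreeIdx L → SU2) := Measure.pi fun _ : TreeIdx L => haarProbability SU2 with hτ
  set ω : Measure (OffIdx L → SU2) := Measure.pi fun _ : OffIdx L => haarProbability SU2 with hω
  have hA := measurable_ringCons (L := L)
  -- step 1: split off slice 0
  have h1 : ∫⁻ p, G p ∂(ringMeasure L) =
      ∫⁻ q, G ((Fin.cons q.1 q.2.1 : Fin (2 * L - 1 + 1) → GaugeConfig 3 L SU2), q.2.2)
        ∂((configMeasure SU2 L).prod ρ) := by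
    have e : ∀ p : (Fin (2 * L - 1 + 1) → GaugeConfig 3 L SU2) × (Site 3 L → SU2),
        G p = (fun q : GaugeConfig 3 L SU2 × ((Fin (2 * L - 1) → GaugeConfig 3 L SU2) × (Site 3 L → SU2)) =>
          G ((Fin.cons q.1 q.2.1 : Fin (2 * L - 1 + 1) → GaugeConfig 3 L SU2), q.2.2))
          (p.1 0, ((fun j : Fin (2 * L - 1) => p.1 j.succ), p.2)) := by
      intro p
      show G p = G (Fin.cons (p.1 0) (Fin.tail p.1), p.2)
      rw [Fin.cons_self_tail]
    rw [lintegral_congr e]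
    exact measurePreserving_ringSplit.lintegral_comp (hG.comp hA)
  -- step 2: slice 0 in comb-gauge coordinates `(t, w)`
  have h2 : ∫⁻ q, G ((Fin.cons q.1 q.2.1 : Fin (2 * L - 1 + 1) → GaugeConfig 3 L SU2), q.2.2)
        ∂((configMeasure SU2 L).prod ρ) =
      ∫⁻ q, G ((Fin.cons (recon q.1) q.2.1 : Fin (2 * L - 1 + 1) → GaugeConfig 3 L SU2), q.2.2)
        ∂((τ.prod ω).prod ρ) := by
    have hm : MeasurePreserving (Prod.map (recon (L := L)) id) ((τ.prod ω).prod ρ) ((configMeasure SU2 L).prod ρ) :=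
      measurePreserving_recon.prod (MeasurePreserving.id ρ)
    have key := hm.lintegral_comp
      (f := fun q : GaugeConfig 3 L SU2 × ((Fin (2 * L - 1) → GaugeConfig 3 L SU2) × (Site 3 L → SU2)) =>
        G ((Fin.cons q.1 q.2.1 : Fin (2 * L - 1 + 1) → GaugeConfig 3 L SU2), q.2.2)) (hG.comp hA)
    rw [← key]
    simp only [Prod.map_fst, Prod.map_snd, id_eq]
  -- step 3: for fixed `(t, w)`, gauge invariance moves the transporter onto the other slices and the seam, where `ρ` is invariant
  have h3 : ∀ q : (TreeIdx L → SU2) × (OffIdx L → SU2),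
      ∫⁻ r, G ((Fin.cons (recon q) r.1 : Fin (2 * L - 1 + 1) → GaugeConfig 3 L SU2), r.2) ∂ρ =
        ∫⁻ r, G ((Fin.cons (glue q.2) r.1 : Fin (2 * L - 1 + 1) → GaugeConfig 3 L SU2), r.2) ∂ρ := by
    intro q
    set γ : Site 3 L → SU2 := treeGauge (recon q) with hγ
    have hfix : gaugeTransform γ (recon q) = glue q.2 := by rw [hγ]; exact treeFix_recon q
    have hpt : ∀ r : (Fin (2 * L - 1) → GaugeConfig 3 L SU2) × (Site 3 L → SU2),
        G ((Fin.cons (recon q) r.1 : Fin (2 * L - 1 + 1) → GaugeConfig 3 L SU2), r.2) =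
          G ((Fin.cons (glue q.2) (fun j => gaugeTransform γ (r.1 j)) : Fin (2 * L - 1 + 1) → GaugeConfig 3 L SU2),
            γ * r.2 * (γ ∘ κ)⁻¹) := by
      intro r
      rw [← hinv γ ((Fin.cons (recon q) r.1 : Fin (2 * L - 1 + 1) → GaugeConfig 3 L SU2), r.2)]
      congr 1
      refine Prod.ext ?_ rfl
      funext i
      refine Fin.cases ?_ (fun j => ?_) i
      · simp only [Fin.cons_zero, hfix]
      · simp only [Fin.cons_succ]
    have ha : MeasurePreserving (fun Us : Fin (2 * L - 1) → GaugeConfig 3 L SU2 => fun j => gaugeTransform γ (Us j))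
        (Measure.pi fun _ : Fin (2 * L - 1) => configMeasure SU2 L)
        (Measure.pi fun _ : Fin (2 * L - 1) => configMeasure SU2 L) :=
      measurePreserving_pi (f := fun (_ : Fin (2 * L - 1)) (U : GaugeConfig 3 L SU2) => gaugeTransform γ U) _ _
        fun _ => Literature.Barriers.QuantumFields.Elitzur.measurePreserving_gaugeTransform γ
    have hb : MeasurePreserving (fun g : Site 3 L → SU2 => γ * g * (γ ∘ κ)⁻¹) (gaugeMeasure L) (gaugeMeasure L) :=
      measurePreserving_pi (f := fun (x : Site 3 L) (u : SU2) => γ x * u * (γ (κ x))⁻¹) _ _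
        fun x => measurePreserving_mul_mul_inv_haarProbability (γ x) (γ (κ x))
    have hρinv : MeasurePreserving
        (Prod.map (fun Us : Fin (2 * L - 1) → GaugeConfig 3 L SU2 => fun j => gaugeTransform γ (Us j))
          (fun g : Site 3 L → SU2 => γ * g * (γ ∘ κ)⁻¹)) ρ ρ := ha.prod hb
    have hGw : Measurable fun r : (Fin (2 * L - 1) → GaugeConfig 3 L SU2) × (Site 3 L → SU2) =>
        G ((Fin.cons (glue q.2) r.1 : Fin (2 * L - 1 + 1) → GaugeConfig 3 L SU2), r.2) :=
      hG.comp (hA.comp (measurable_const.prodMk measurable_id))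
    rw [lintegral_congr hpt, ← hρinv.lintegral_comp hGw]
    simp only [Prod.map_fst, Prod.map_snd]
  -- step 4: iterate, rewrite the inner integral, and integrate out the tree links
  have hK : Measurable fun x : ((TreeIdx L → SU2) × (OffIdx L → SU2)) ×
      ((Fin (2 * L - 1) → GaugeConfig 3 L SU2) × (Site 3 L → SU2)) =>
        G ((Fin.cons (recon x.1) x.2.1 : Fin (2 * L - 1 + 1) → GaugeConfig 3 L SU2), x.2.2) :=
    hG.comp (hA.comp ((measurable_recon.comp measurable_fst).prodMk measurable_snd))
  have hΦ : Measurable fun w : OffIdx L → SU2 =>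
      ∫⁻ r, G ((Fin.cons (glue w) r.1 : Fin (2 * L - 1 + 1) → GaugeConfig 3 L SU2), r.2) ∂ρ :=
    Measurable.lintegral_prod_right (f := fun (w : OffIdx L → SU2)
        (r : (Fin (2 * L - 1) → GaugeConfig 3 L SU2) × (Site 3 L → SU2)) =>
          G ((Fin.cons (glue w) r.1 : Fin (2 * L - 1 + 1) → GaugeConfig 3 L SU2), r.2))
      (hG.comp (hA.comp ((measurable_glue.comp measurable_fst).prodMk measurable_snd)))
  rw [h1, h2, lintegral_prod _ hK.aemeasurable]
  simp only [h3]
  rw [lintegral_prod (fun x : (TreeIdx L → SU2) × (OffIdx L → SU2) =>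
      ∫⁻ r, G ((Fin.cons (glue x.2) r.1 : Fin (2 * L - 1 + 1) → GaugeConfig 3 L SU2), r.2) ∂ρ)
    (hΦ.comp measurable_snd).aemeasurable]
  simp only [lintegral_const, measure_univ, mul_one]

/-- ★ **The ring integral in tree gauge, re-indexed seam action** (real-valued, `0 ≤ G ≤ C`). [cite: SeilerLNP1982, §2] -/
theorem integral_ringMeasure_eq_treeGauge_seam (κ : Site 3 L → Site 3 L)
    {G : (Fin (2 * L - 1 + 1) → GaugeConfig 3 L SU2) × (Site 3 L → SU2) → ℝ} (hG : Measurable G)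
    (hinv : ∀ (h : Site 3 L → SU2) (p : (Fin (2 * L - 1 + 1) → GaugeConfig 3 L SU2) × (Site 3 L → SU2)),
      G ((fun i => gaugeTransform h (p.1 i)), h * p.2 * (h ∘ κ)⁻¹) = G p)
    (h0 : ∀ p, 0 ≤ G p) {C : ℝ} (hC : ∀ p, G p ≤ C) :
    ∫ p, G p ∂(ringMeasure L) =
      ∫ w, (∫ r, G ((Fin.cons (glue w) r.1 : Fin (2 * L - 1 + 1) → GaugeConfig 3 L SU2), r.2)
        ∂((Measure.pi fun _ : Fin (2 * L - 1) => configMeasure SU2 L).prod (gaugeMeasure L)))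
        ∂(Measure.pi fun _ : OffIdx L => haarProbability SU2) := by
  haveI : IsProbabilityMeasure (gaugeMeasure L) := by unfold gaugeMeasure; infer_instance
  haveI : IsProbabilityMeasure (ringMeasure L) := by unfold ringMeasure; infer_instance
  set ρ : Measure ((Fin (2 * L - 1) → GaugeConfig 3 L SU2) × (Site 3 L → SU2)) :=
    (Measure.pi fun _ : Fin (2 * L - 1) => configMeasure SU2 L).prod (gaugeMeasure L) with hρ
  have hA := measurable_ringCons (L := L)
  have hG' : Measurable fun p => ENNReal.ofReal (G p) := ENNReal.measurable_ofReal.comp hG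
  have key := lintegral_ringMeasure_eq_treeGauge_seam (L := L) κ hG' (fun h p => by simp only [hinv h p])
  -- left-hand side as a lintegral
  have hL : ∫ p, G p ∂(ringMeasure L) = (∫⁻ p, ENNReal.ofReal (G p) ∂(ringMeasure L)).toReal :=
    integral_eq_lintegral_of_nonneg_ae (Eventually.of_forall h0) hG.aestronglyMeasurable
  -- inner integrals as lintegrals
  have hin : ∀ w : OffIdx L → SU2,
      ∫ r, G ((Fin.cons (glue w) r.1 : Fin (2 * L - 1 + 1) → GaugeConfig 3 L SU2), r.2) ∂ρ =
        (∫⁻ r, ENNReal.ofReal (G ((Fin.cons (glue w) r.1 : Fin (2 * L - 1 + 1) → GaugeConfig 3 L SU2), r.2)) ∂ρ).toReal :=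
    fun w => integral_eq_lintegral_of_nonneg_ae (Eventually.of_forall fun r => h0 _)
      (hG.comp (hA.comp (measurable_const.prodMk measurable_id))).aestronglyMeasurable
  have hΦ : Measurable fun w : OffIdx L → SU2 =>
      ∫⁻ r, ENNReal.ofReal (G ((Fin.cons (glue w) r.1 : Fin (2 * L - 1 + 1) → GaugeConfig 3 L SU2), r.2)) ∂ρ :=
    Measurable.lintegral_prod_right (f := fun (w : OffIdx L → SU2)
        (r : (Fin (2 * L - 1) → GaugeConfig 3 L SU2) × (Site 3 L → SU2)) =>
          ENNReal.ofReal (G ((Fin.cons (glue w) r.1 : Fin (2 * L - 1 + 1) → GaugeConfig 3 L SU2), r.2)))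
      (hG'.comp (hA.comp ((measurable_glue.comp measurable_fst).prodMk measurable_snd)))
  have hfin : ∀ᵐ w ∂(Measure.pi fun _ : OffIdx L => haarProbability SU2),
      ∫⁻ r, ENNReal.ofReal (G ((Fin.cons (glue w) r.1 : Fin (2 * L - 1 + 1) → GaugeConfig 3 L SU2), r.2)) ∂ρ < ∞ := by
    refine Eventually.of_forall fun w => ?_
    calc ∫⁻ r, ENNReal.ofReal (G ((Fin.cons (glue w) r.1 : Fin (2 * L - 1 + 1) → GaugeConfig 3 L SU2), r.2)) ∂ρ
        ≤ ∫⁻ _, ENNReal.ofReal C ∂ρ := lintegral_mono fun r => ENNReal.ofReal_le_ofReal (hC _)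
      _ < ∞ := by rw [lintegral_const]; exact ENNReal.mul_lt_top ENNReal.ofReal_lt_top (measure_lt_top _ _)
  rw [hL, key]
  simp_rw [hin]
  exact (integral_toReal hΦ.aemeasurable hfin).symm

/-! ## Transfer to the reduced product group `X_fix` (Fubini), for the re-indexed seam action -/

/-- ★ **The ring integral of a bounded measurable functional invariant under the re-indexed seam action equals its integral over the
reduced product group** `X_fix = SU(2)^{off} × (slices 1…2L−1) × (seam)` with product Haar (`lintegral_ringMeasure_eq_treeGauge_seam` + Fubini;
the `κ = id` case is ✓`TreeGaugeTransfer.integral_ringMeasure_eq_integral_fix`). [cite: SeilerLNP1982, §2] -/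
theorem integral_ringMeasure_eq_integral_fix_seam (κ : Site 3 L → Site 3 L)
    {G : (Fin (2 * L - 1 + 1) → GaugeConfig 3 L SU2) × (Site 3 L → SU2) → ℝ} (hG : Measurable G)
    (hinv : ∀ (h : Site 3 L → SU2) (p : (Fin (2 * L - 1 + 1) → GaugeConfig 3 L SU2) × (Site 3 L → SU2)),
      G ((fun i => gaugeTransform h (p.1 i)), h * p.2 * (h ∘ κ)⁻¹) = G p)
    (h0 : ∀ p, 0 ≤ G p) {C : ℝ} (hC : ∀ p, G p ≤ C) :
    ∫ p, G p ∂(ringMeasure L) =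
      ∫ x, G ((Fin.cons (glue x.1) x.2.1 : Fin (2 * L - 1 + 1) → GaugeConfig 3 L SU2), x.2.2)
        ∂((Measure.pi fun _ : OffIdx L => haarProbability SU2).prod
          ((Measure.pi fun _ : Fin (2 * L - 1) => configMeasure SU2 L).prod (gaugeMeasure L))) := by
  haveI : IsProbabilityMeasure (gaugeMeasure L) := by unfold gaugeMeasure; infer_instance
  rw [integral_ringMeasure_eq_treeGauge_seam κ hG hinv h0 hC]
  symm
  refine integral_prod (f := fun x : (OffIdx L → SU2) × ((Fin (2 * L - 1) → GaugeConfig 3 L SU2) × (Site 3 L → SU2)) =>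
    G ((Fin.cons (glue x.1) x.2.1 : Fin (2 * L - 1 + 1) → GaugeConfig 3 L SU2), x.2.2)) ?_
  refine Integrable.of_bound
    ((hG.comp ((measurable_ringCons (L := L)).comp ((measurable_glue.comp measurable_fst).prodMk measurable_snd))).aestronglyMeasurable)
    C (ae_of_all _ fun x => ?_)
  rw [Real.norm_eq_abs, abs_of_nonneg (h0 _)]
  exact hC _

/-- ★ **Transfer of sublevel volumes for a functional invariant under the re-indexed seam action**: `μ_L{F ≤ s} = μ_fix{F ∘ fix ≤ s}`
(indicators through `integral_ringMeasure_eq_integral_fix_seam`; the `κ = id` case is ✓`TreeGaugeTransfer.measureReal_deficit_le_eq_fix`).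
[cite: SeilerLNP1982, §2] -/
theorem measureReal_le_eq_fix_seam (κ : Site 3 L → Site 3 L)
    {F : (Fin (2 * L - 1 + 1) → GaugeConfig 3 L SU2) × (Site 3 L → SU2) → ℝ} (hF : Measurable F)
    (hinv : ∀ (h : Site 3 L → SU2) (p : (Fin (2 * L - 1 + 1) → GaugeConfig 3 L SU2) × (Site 3 L → SU2)),
      F ((fun i => gaugeTransform h (p.1 i)), h * p.2 * (h ∘ κ)⁻¹) = F p) (s : ℝ) :
    (ringMeasure L).real {p | F p ≤ s} =
      ((Measure.pi fun _ : OffIdx L => haarProbability SU2).prod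
          ((Measure.pi fun _ : Fin (2 * L - 1) => configMeasure SU2 L).prod (gaugeMeasure L))).real
        {x | F ((Fin.cons (glue x.1) x.2.1 : Fin (2 * L - 1 + 1) → GaugeConfig 3 L SU2), x.2.2) ≤ s} := by
  haveI : IsProbabilityMeasure (gaugeMeasure L) := by unfold gaugeMeasure; infer_instance
  haveI : IsProbabilityMeasure (ringMeasure L) := by unfold ringMeasure; infer_instance
  have hS : MeasurableSet {p : (Fin (2 * L - 1 + 1) → GaugeConfig 3 L SU2) × (Site 3 L → SU2) | F p ≤ s} :=
    measurableSet_le hF measurable_const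
  have hcomp : Measurable fun x : (OffIdx L → SU2) × ((Fin (2 * L - 1) → GaugeConfig 3 L SU2) × (Site 3 L → SU2)) =>
      F ((Fin.cons (glue x.1) x.2.1 : Fin (2 * L - 1 + 1) → GaugeConfig 3 L SU2), x.2.2) :=
    hF.comp ((measurable_ringCons (L := L)).comp ((measurable_glue.comp measurable_fst).prodMk measurable_snd))
  have hS' : MeasurableSet {x : (OffIdx L → SU2) × ((Fin (2 * L - 1) → GaugeConfig 3 L SU2) × (Site 3 L → SU2)) |
      F ((Fin.cons (glue x.1) x.2.1 : Fin (2 * L - 1 + 1) → GaugeConfig 3 L SU2), x.2.2) ≤ s} :=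
    measurableSet_le hcomp measurable_const
  have h := integral_ringMeasure_eq_integral_fix_seam (L := L) κ
    (G := fun p => ({p | F p ≤ s} : Set _).indicator (fun _ => (1 : ℝ)) p)
    (measurable_const.indicator hS) (fun h p => by
      simp only [Set.indicator_apply, Set.mem_setOf_eq, hinv])
    (fun p => Set.indicator_nonneg (fun _ _ => zero_le_one) _) (C := 1)
    (fun p => Set.indicator_le_self' (fun _ _ => zero_le_one) _)
  rw [integral_indicator hS, setIntegral_const, smul_eq_mul, mul_one] at h
  rw [h]
  have e : (fun x : (OffIdx L → SU2) × ((Fin (2 * L - 1) → GaugeConfig 3 L SU2) × (Site 3 L → SU2)) =>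
      ({p : (Fin (2 * L - 1 + 1) → GaugeConfig 3 L SU2) × (Site 3 L → SU2) | F p ≤ s} : Set _).indicator
        (fun _ => (1 : ℝ)) ((Fin.cons (glue x.1) x.2.1 : Fin (2 * L - 1 + 1) → GaugeConfig 3 L SU2), x.2.2)) =
      ({x : (OffIdx L → SU2) × ((Fin (2 * L - 1) → GaugeConfig 3 L SU2) × (Site 3 L → SU2)) |
        F ((Fin.cons (glue x.1) x.2.1 : Fin (2 * L - 1 + 1) → GaugeConfig 3 L SU2), x.2.2) ≤ s} : Set _).indicator
        fun _ => (1 : ℝ) := by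
    funext x
    simp only [Set.indicator_apply, Set.mem_setOf_eq]
  rw [e, integral_indicator hS', setIntegral_const, smul_eq_mul, mul_one]

end Summit.QuantumFields.YangMills.Theorems.VirialFluxGap.RingDeficit

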